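import Literature.GroupTheory.CombinatorialGroupTheory.PuncturedSurfaceGroup
import Mathlib.GroupTheory.Index
import Mathlib.Algebra.Group.End
import HarnessLib

/-!
# Finite-index subgroups of punctured surface groups (Riemann–Hurwitz with peripheral structure) —
# NAMED FACT

Topic `Literature/GroupTheory/CombinatorialGroupTheory`.  The punctured twin of
`SurfaceGroupFiniteIndexSubgroup` (`SurfaceGroupConjugacySeparable.lean`): for the punctured surface
group `Γ_{g,r} = ⟨a₁, b₁, …, a_g, b_g, c₁, …, c_r ∣ [a₁,b₁]⋯[a_g,b_g]·c₁⋯c_r⟩` (`PuncturedSurfaceGroup g r`)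
of hyperbolic type `2g − 2 + r > 0`, a subgroup `K` of finite index `d` is again a punctured surface
group `Γ_{g',r'}`, `2g' − 2 + r' = d · (2g − 2 + r)` (Euler characteristic of a `d`-sheeted covering),
and the ISOMORPHISM CARRIES THE PERIPHERAL (CUSP) STRUCTURE: the standard cusp subgroups `⟨c'_{j'}⟩` of
`Γ_{g',r'}` go bijectively onto the subgroups `K ∩ γ⟨c_j⟩γ⁻¹` taken over a system of representatives
`(j, γ)` of the double cosets `⨆_j K\Γ_{g,r}/⟨c_j⟩` — the cusps of the covering surface, each lying over
a cusp `j` of the base with its ramification.  Classical: covering-space theory of surfaces of finite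
type; algebraically Hoare–Karrass–Solitar, *Subgroups of finite index of Fuchsian groups*, Math. Z.
120 (1971) 289–298, Thm 1, and Zieschang–Vogt–Coldewey, *Surfaces and Planar Discontinuous Groups*,
LNM 835 (1980), Thm 4.14.1 (the Reidemeister–Schreier rewriting of a planar presentation is planar)
with §4.14 (Riemann–Hurwitz).  Typed as a NAMED FACT (`def … : Prop`, D-0014: not proved here, never
asserted); consumer: [SemiAnbd] Example 2.10 (semi-graphs of anabelioids of surface type are stable
under finite étale coverings).  Deliberately NOT here: the closed case `r = 0` (that is
`SurfaceGroupFiniteIndexSubgroup`), non-orientable surfaces, torsion.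
-/

namespace Literature.GroupTheory.CombinatorialGroupTheory

namespace PuncturedSurfaceGroup

variable {g r : ℕ}

/-- The *peripheral (cusp) subgroup* of `Γ_{g,r}` attached to the cusp `j` and `γ ∈ Γ_{g,r}`, seen from a
subgroup `K`: `K ∩ γ⟨c_j⟩γ⁻¹` — for `K` of finite index, the fundamental group of the cusp of the
covering surface `K\ℍ` lying over `j` at the sheet `Kγ`; it depends only on the double coset `Kγ⟨c_j⟩`
up to `K`-conjugacy. [cite: ZieschangVogtColdewey1980, Thm 4.14.1 p.150] -/
def peripheralSubgroup (K : Subgroup (PuncturedSurfaceGroup g r)) (j : Fin r)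
    (γ : PuncturedSurfaceGroup g r) : Subgroup (PuncturedSurfaceGroup g r) :=
  K ⊓ (cuspInertia j).map (MulAut.conj γ).toMonoidHom

end PuncturedSurfaceGroup

open PuncturedSurfaceGroup in
/-- **Finite-index subgroups of punctured surface groups are punctured surface groups, with the induced
peripheral structure (Riemann–Hurwitz)**, as a named fact: for `2 < 2g + r` and `K ≤ Γ_{g,r}` of finite
index `d`, there are `g', r'` with `2 < 2g' + r'` and `2g' + r' − 2 = d · (2g + r − 2)` (written without
subtraction), an injective homomorphism `θ : Γ_{g',r'} → Γ_{g,r}` with image `K`, and for each cusp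
`j' < r'` of `Γ_{g',r'}` a cusp `cusp j' < r` and a sheet representative `rep j' ∈ Γ_{g,r}` such that
`θ⟨c'_{j'}⟩ = K ∩ (rep j')⟨c_{cusp j'}⟩(rep j')⁻¹`, the assignment `j' ↦ (cusp j', K·(rep j')·⟨c_{cusp j'}⟩)`
being a BIJECTION onto the double cosets `⨆_{j<r} K\Γ_{g,r}/⟨c_j⟩` (the cusps of the `d`-sheeted
covering and the cusps of the base they lie over).  Hoare–Karrass–Solitar, Math. Z. 120 (1971) Thm 1;
Zieschang–Vogt–Coldewey LNM 835, Thm 4.14.1 and §4.14.  A `Prop`-valued definition: NOT proved here.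
[cite: ZieschangVogtColdewey1980, Thm 4.14.1 p.150] -/
def PuncturedSurfaceGroupFiniteIndexSubgroup : Prop :=
  ∀ (g r : ℕ), IsHyperbolicType g r →
    ∀ (K : Subgroup (PuncturedSurfaceGroup g r)), K.FiniteIndex →
      ∃ (g' r' : ℕ) (θ : PuncturedSurfaceGroup g' r' →* PuncturedSurfaceGroup g r)
        (cusp : Fin r' → Fin r) (rep : Fin r' → PuncturedSurfaceGroup g r),
        IsHyperbolicType g' r' ∧ Function.Injective θ ∧ θ.range = K ∧
        2 * g' + r' + 2 * K.index = K.index * (2 * g + r) + 2 ∧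
        (∀ j' : Fin r', (cuspInertia j').map θ = peripheralSubgroup K (cusp j') (rep j')) ∧
        ∀ (j : Fin r) (γ : PuncturedSurfaceGroup g r), ∃! j' : Fin r', cusp j' = j ∧
          ∃ k ∈ K, ∃ z ∈ cuspInertia j, rep j' = k * γ * z

end Literature.GroupTheory.CombinatorialGroupTheory
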